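import Summits.QuantumFields.YangMills.Theorems.UnitScaleTiltProp7QTwFlatExplicitT3
import Summits.QuantumFields.YangMills.Theorems.UnitScaleTiltProp7CentreStairLegsFlat
import Summits.QuantumFields.YangMills.Theorems.UnitScaleTiltProp7CornerFrameLegsFlatRow
import HarnessLib

/-!
# Route `UnitScaleTilt`, crux K1 «MinimiserStabilityRegPr» (stmt-QuantumFields-19200), LANE II (QH1)♮ — THE FLAT ROW, UNCONDITIONAL:
# `ℓ·Σ_c‖QTw 1 X c‖² ≤ C₁·Σ‖X‖² + C₂·ℓ²·(gradient energy)` at the flat member, `C₁ C₂` L-only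

Cell `ym3-torus`, width seat `ym3-torus-px22` (gen 6).  THEOREMS ONLY (0 `def`, 0 `sorry`); `--supports stmt-QuantumFields-19200 --as helper`, count-neutral.
YM₃ on T³ is a ladder rung (R3) — NOT d = 4, NOT infinite volume, NOT a mass gap, NOT the Clay problem; nothing here claims a stub, the crux or the gap.

THE POINT.  Print's twisted comb averaging operator at the flat member is `QTw 1 X = Lᵏ•Q_kX − ∇Λ_kX + ∇r₁X` (★px21 ✓`Prop7QTwFlatExplicit.QTw_one_eq_tube_sub_coarseGrad`):
the straight tube (an `ℓ`-normalised `ℓ²` contraction, §1), the centre-stair legs (✓p712697 `Prop7CentreStairLegsFlat.slegs_flat_T3`) and the corner-frame trunk (★px19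
✓p715851 `Prop7CornerFrameLegsFlatRow.rlegs_flat`, unconditional) — the two leg rows are `H¹` rows with L-only constants times `ℓ`.  This file knits the three by name
into the flat (QH1)♮ row, the central-sector input of `hQH1` (px22 LOCATE v4 §4 (c); measured least constant at `B = 1`: `B′ = 0.602 ∕ 0.815 ∕ 0.947 ∕ 1.024` for `k = 1…4`, L = 3).

* §1 `sum_norm_sq_bondAvgIter_le` — `Σ_c ‖Q_kX(c)‖² ≤ (L^{−d})ᵏ·Σ_b ‖X b‖²` (px6 ✓`Prop7OneStepL2Bounds.sum_norm_sq_smul_bondAvg_le` iterated), hence at d = 3 the tube's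
  `ℓ`-normalised op-norm is `1`: `ℓ·Σ_ĉ ‖ℓ•Q_kX(ĉ)‖² ≤ Σ_b‖X b‖²` (`ell_mul_sum_norm_sq_tube_le_T3`).
* §2 ★★★ `QTw_one_H1_row` — `∀ L > 1 ∃ C₁ C₂ ≥ 0, ∀ F (F.L = L) n K (n < K) X, ℓ·Σ_c ‖QTw F n K _ 1 X c‖² ≤ C₁·Σ_b‖X b‖² + C₂·ℓ²·Σ_xΣ_κΣ_ν ‖X(x+e_ν,κ) − X(x,κ)‖²`
  (`C₁ = 3`, `C₂ = 3·(CΛ + Cr)`).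

HONEST SCOPE.  Flat member only; a knit of landed rows; nothing of (QH1)♮ at curved `W`, `hQH1`, (REC), `hN06`, EX or the crux is proved here.

References: T. Bałaban, CMP 95 (1984) 17–40 [Balaban1984PropagatorsI] ((1.11) p.19, (1.18)–(1.20) pp.19–20); CMP 98 (1985) 17–51 [Balaban1985Averaging] ((62) p.28,
(124)–(127) pp.36–37, (160) p.42); CMP 102 (1985) 277–309 [Balaban1985Variational] ((44) p.285, Prop. 7 p.299).
-/

noncomputable section

open scoped BigOperators Matrix.Norms.L2Operator Matrix

namespace Summit.QuantumFields.YangMills.Theorems.Prop7QTwOneH1Row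

open Literature.MathematicalPhysics.QuantumFieldTheory.Balaban1983to89
open Literature.MathematicalPhysics.QuantumFieldTheory.Balaban1983to89.T3ContinuumYM3Torus
open T3LevelShift (bondShift)
open T3PrintedRegularOrbits (sites_eq)
open B7Prop3Flat (Fhat)
open B7Prop4Flat (linQIter)
open B10Eq27TorusAxialLog (transl)
open T4Continuum BlockAveraging LatticeFieldCalculus
open BlockAveragingEMLLinearised (linAvg combMean)
open Summit.QuantumFields.YangMills.Theorems.Prop7SPrint (basePt)
open Summit.QuantumFields.YangMills.Theorems.Prop7SymAvgTw (coordT3 QTw)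
open Summit.QuantumFields.YangMills.Theorems.Prop7QTwFlatExplicit (QTw_one_eq_tube_sub_coarseGrad)
open Summit.QuantumFields.YangMills.Theorems.ChartHInv (exists_linFamily exists_combFamily)
open Summit.QuantumFields.YangMills.Theorems.Prop7OneStepL2Bounds (sum_norm_sq_smul_bondAvg_le)
open Summit.QuantumFields.YangMills.Theorems.Prop7CentreStairLegsFlat (slegs_flat_T3 energy_eq_sum_bond)
open Summit.QuantumFields.YangMills.Theorems.Prop7CornerFrameLegsFlatRow (rlegs_flat)

/-! ## §1 The k-fold straight tube is an `ℓ`-normalised contraction -/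

/-- **THE k-FOLD TUBE IN `ℓ²`**: `Σ_{c : level k} ‖Q_kX(c)‖² ≤ (L^{−d})ᵏ·Σ_b ‖X b‖²` (px6's one-step row `Σ‖L•QA‖² ≤ (L²∕L^d)Σ‖A‖²` iterated).
[cite: Balaban1984PropagatorsI, (1.11) p.19, (1.18) p.20] -/
theorem sum_norm_sq_bondAvgIter_le {P : Params} {V : Type*} [NormedAddCommGroup V] [NormedSpace ℝ V] (X : PBond P 0 → V) :
    ∀ (k : ℕ), k ≤ P.m + P.K → ∑ c : PBond P k, ‖bondAvgIter k X c‖ ^ 2 ≤ (((P.L : ℝ) ^ P.d)⁻¹) ^ k * ∑ b : PBond P 0, ‖X b‖ ^ 2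
  | 0, _ => by simp [bondAvgIter]
  | k + 1, hk => by
    have hL : (0 : ℝ) < P.L := by exact_mod_cast P.L_pos
    have ih := sum_norm_sq_bondAvgIter_le X k (Nat.le_of_succ_le hk)
    have hstep := sum_norm_sq_smul_bondAvg_le (P := P) hk (bondAvgIter k X)
    have hiter : bondAvgIter (k + 1) X = bondAvg (bondAvgIter k X) := rfl
    have hsm : ∀ c : PBond P (k + 1), ‖(P.L : ℝ) • bondAvg (bondAvgIter k X) c‖ ^ 2 = (P.L : ℝ) ^ 2 * ‖bondAvg (bondAvgIter k X) c‖ ^ 2 := by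
      intro c; rw [norm_smul, Real.norm_natCast, mul_pow]
    rw [Finset.sum_congr rfl (fun c _ => hsm c), ← Finset.mul_sum] at hstep
    rw [hiter]
    have hL2 : (0 : ℝ) < (P.L : ℝ) ^ 2 := by positivity
    have h1 : ∑ c : PBond P (k + 1), ‖bondAvg (bondAvgIter k X) c‖ ^ 2 ≤ ((P.L : ℝ) ^ P.d)⁻¹ * ∑ b : PBond P k, ‖bondAvgIter k X b‖ ^ 2 := by
      have e : (P.L : ℝ) ^ 2 / (P.L : ℝ) ^ P.d * ∑ b : PBond P k, ‖bondAvgIter k X b‖ ^ 2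
          = (P.L : ℝ) ^ 2 * (((P.L : ℝ) ^ P.d)⁻¹ * ∑ b : PBond P k, ‖bondAvgIter k X b‖ ^ 2) := by ring
      rw [e] at hstep
      exact le_of_mul_le_mul_left hstep hL2
    calc ∑ c : PBond P (k + 1), ‖bondAvg (bondAvgIter k X) c‖ ^ 2
        ≤ ((P.L : ℝ) ^ P.d)⁻¹ * ∑ b : PBond P k, ‖bondAvgIter k X b‖ ^ 2 := h1
      _ ≤ ((P.L : ℝ) ^ P.d)⁻¹ * ((((P.L : ℝ) ^ P.d)⁻¹) ^ k * ∑ b : PBond P 0, ‖X b‖ ^ 2) := mul_le_mul_of_nonneg_left ih (by positivity)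
      _ = (((P.L : ℝ) ^ P.d)⁻¹) ^ (k + 1) * ∑ b : PBond P 0, ‖X b‖ ^ 2 := by ring

/-- **THE TUBE's `ℓ`-NORMALISED OP-NORM IS ONE ON THE T³ FAMILY** (d = 3, `ℓ = L^{K−n}`): `ℓ·Σ_ĉ ‖(ℓ : ℂ)•Q_{K−n}X(ĉ)‖² ≤ Σ_b‖X b‖²`.
[cite: Balaban1984PropagatorsI, (1.18) p.20] -/
theorem ell_mul_sum_norm_sq_tube_le_T3 (F : T3Family) (n K : ℕ) (hnK : n ≤ K) (X : PBond (F.P K) 0 → Matrix (Fin 2) (Fin 2) ℂ) :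
    (F.L : ℝ) ^ (K - n) * ∑ c : PBond (F.P K) (K - n), ‖((((F.P K).L : ℕ) : ℂ) ^ (K - n)) • bondAvgIter (K - n) X c‖ ^ 2
      ≤ ∑ b : PBond (F.P K) 0, ‖X b‖ ^ 2 := by
  have hd : (F.P K).d = 3 := rfl
  have hLF : ((F.P K).L : ℝ) = (F.L : ℝ) := rfl
  have hL : (0 : ℝ) < F.L := by have := F.hL.2; positivity
  have hk : K - n ≤ (F.P K).m + (F.P K).K := by show K - n ≤ F.m + K; omega
  have h := sum_norm_sq_bondAvgIter_le (P := F.P K) X (K - n) hk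
  rw [hd, hLF] at h
  have hsm : ∀ c : PBond (F.P K) (K - n), ‖((((F.P K).L : ℕ) : ℂ) ^ (K - n)) • bondAvgIter (K - n) X c‖ ^ 2
      = ((F.L : ℝ) ^ (K - n)) ^ 2 * ‖bondAvgIter (K - n) X c‖ ^ 2 := by
    intro c
    rw [norm_smul, norm_pow, Complex.norm_natCast, mul_pow]
    rfl
  rw [Finset.sum_congr rfl (fun c _ => hsm c), ← Finset.mul_sum]
  have hY0 : 0 ≤ ∑ b : PBond (F.P K) 0, ‖X b‖ ^ 2 := Finset.sum_nonneg fun _ _ => sq_nonneg _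
  have e : (F.L : ℝ) ^ (K - n) * (((F.L : ℝ) ^ (K - n)) ^ 2 * ((((F.L : ℝ) ^ 3)⁻¹) ^ (K - n) * ∑ b : PBond (F.P K) 0, ‖X b‖ ^ 2))
      = ∑ b : PBond (F.P K) 0, ‖X b‖ ^ 2 := by
    have hℓ : (F.L : ℝ) ^ (K - n) ≠ 0 := pow_ne_zero _ hL.ne'
    have e3 : (((F.L : ℝ) ^ 3)⁻¹) ^ (K - n) = (((F.L : ℝ) ^ (K - n)) ^ 3)⁻¹ := by
      rw [inv_pow, ← pow_mul, ← pow_mul, mul_comm]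
    rw [e3]
    field_simp
  calc (F.L : ℝ) ^ (K - n) * (((F.L : ℝ) ^ (K - n)) ^ 2 * ∑ c : PBond (F.P K) (K - n), ‖bondAvgIter (K - n) X c‖ ^ 2)
      ≤ (F.L : ℝ) ^ (K - n) * (((F.L : ℝ) ^ (K - n)) ^ 2 * ((((F.L : ℝ) ^ 3)⁻¹) ^ (K - n) * ∑ b : PBond (F.P K) 0, ‖X b‖ ^ 2)) :=
        mul_le_mul_of_nonneg_left (mul_le_mul_of_nonneg_left h (by positivity)) (by positivity)
    _ = ∑ b : PBond (F.P K) 0, ‖X b‖ ^ 2 := e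

/-! ## §2 ★★★ The flat (QH1)♮ row -/

/-- `‖a − (b + c)‖² ≤ 3(‖a‖² + ‖b‖² + ‖c‖²)`. [folklore] -/
theorem norm_sub_add_sq_le_three {E : Type*} [SeminormedAddCommGroup E] (a b c : E) :
    ‖a - (b + c)‖ ^ 2 ≤ 3 * (‖a‖ ^ 2 + ‖b‖ ^ 2 + ‖c‖ ^ 2) := by
  have h : ‖a - (b + c)‖ ≤ ‖a‖ + ‖b‖ + ‖c‖ := by
    calc ‖a - (b + c)‖ ≤ ‖a‖ + ‖b + c‖ := norm_sub_le _ _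
      _ ≤ ‖a‖ + (‖b‖ + ‖c‖) := add_le_add le_rfl (norm_add_le _ _)
      _ = ‖a‖ + ‖b‖ + ‖c‖ := by ring
  have ha := norm_nonneg a; have hb := norm_nonneg b; have hc := norm_nonneg c
  have hn := norm_nonneg (a - (b + c))
  nlinarith [pow_le_pow_left₀ hn h 2, sq_nonneg (‖a‖ - ‖b‖), sq_nonneg (‖b‖ - ‖c‖), sq_nonneg (‖a‖ - ‖c‖)]

/-- ★★★ **(QH1)♮ AT THE FLAT MEMBER, UNCONDITIONAL.**  For every `L > 1` there are L-only `C₁ = 3`, `C₂ = 3·(CΛ + Cr)` (`CΛ` of ✓`slegs_flat_T3`, `Cr` of ✓`rlegs_flat`) such that for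
every member (`F.L = L`, `n < K`, `ℓ = L^{K−n}`) and every direction field `X`:
`ℓ·Σ_{c} ‖QTw F n K _ 1 X c‖² ≤ C₁·Σ_b‖X b‖² + C₂·ℓ²·Σ_xΣ_κΣ_ν ‖X(x+e_ν, κ) − X(x, κ)‖²` — the twisted comb average of print's chart at `W = 1` is `H¹`-bounded in the `ℓ`-normalised
currency with L-only constants (tube ⊕ centre stairs ⊕ corner trunk, ✓`QTw_one_eq_tube_sub_coarseGrad`), uniformly in `K`, `n` and the volume.
[cite: Balaban1984PropagatorsI, (1.18)-(1.20) pp.19-20; Balaban1985Averaging, (62) p.28, (124)-(127) pp.36-37, (160) p.42; Balaban1985Variational, (44) p.285] -/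
theorem QTw_one_H1_row : ∀ (L : ℕ), 1 < L → ∃ C₁ C₂ : ℝ, 0 ≤ C₁ ∧ 0 ≤ C₂ ∧
    ∀ (F : T3Family), F.L = L → ∀ (n K : ℕ) (hnK : n < K) (X : PBond (F.P K) 0 → Matrix (Fin 2) (Fin 2) ℂ),
      (F.L : ℝ) ^ (K - n) * ∑ c : PBond (F.P n) 0, ‖QTw F n K hnK.le 1 X c‖ ^ 2
        ≤ C₁ * ∑ b : PBond (F.P K) 0, ‖X b‖ ^ 2
          + C₂ * ((F.L : ℝ) ^ (K - n)) ^ 2 * ∑ x : Site (F.P K) 0, ∑ κ : Fin 3, ∑ ν : Fin 3, ‖X ⟨x.shift ν, κ⟩ - X ⟨x, κ⟩‖ ^ 2 := by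
  intro L hL
  obtain ⟨CΛ, hCΛ, hS⟩ := slegs_flat_T3 L hL
  obtain ⟨Cr, hCr, hR⟩ := rlegs_flat L hL
  refine ⟨3, 3 * (CΛ + Cr), by norm_num, by positivity, ?_⟩
  intro F hFL n K hnK X
  have hL0 : (0 : ℝ) < F.L := by have := F.hL.2; rw [← hFL] at hL; positivity
  set ℓ : ℝ := (F.L : ℝ) ^ (K - n) with hℓ
  have hℓ0 : 0 < ℓ := pow_pos hL0 _
  -- the families of record
  obtain ⟨Q, hQ0, hQs⟩ := exists_linFamily (P := F.P K) (n := Fin 2)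
  obtain ⟨Λ, hΛ0, hΛs⟩ := exists_combFamily (P := F.P K) (n := Fin 2)
  -- the three rows
  have hT := ell_mul_sum_norm_sq_tube_le_T3 F n K hnK.le X
  have hSX := hS F hFL n K hnK.le X (fun k y => Λ k X y) (fun y => hΛ0 X y) (fun k y => hΛs k X y)
  have hRX := hR F hFL n K hnK X
  rw [← energy_eq_sum_bond] at hSX
  -- pointwise: `‖QTw 1 X c‖² ≤ 3(‖tube‖² + ‖stairs‖² + ‖trunk‖²)`
  have hpt : ∀ c : PBond (F.P n) 0, ‖QTw F n K hnK.le 1 X c‖ ^ 2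
      ≤ 3 * (‖((((F.P K).L : ℕ) : ℂ) ^ (K - n)) • bondAvgIter (K - n) X (bondShift (sites_eq F n K hnK.le) c)‖ ^ 2
        + ‖Λ (K - n) X (bondShift (sites_eq F n K hnK.le) c).tgt - Λ (K - n) X (bondShift (sites_eq F n K hnK.le) c).src‖ ^ 2
        + ‖(∑ j ∈ Finset.range (K - n), Fhat (F.P K).L (linQIter (F.P K).L (fun z κ => X ⟨transl (basePt F n K) z, κ⟩) j) ((((F.P K).L : ℤ) ^ (K - n - j)) • coordT3 F n K hnK.le c.src)
            - ∑ j ∈ Finset.range (K - n), Fhat (F.P K).L (linQIter (F.P K).L (fun z κ => X ⟨transl (basePt F n K) z, κ⟩) j) ((((F.P K).L : ℤ) ^ (K - n - j)) • coordT3 F n K hnK.le c.tgt))‖ ^ 2) := by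
    intro c
    rw [QTw_one_eq_tube_sub_coarseGrad F hnK.le Q hQ0 hQs Λ hΛ0 hΛs X c]
    exact norm_sub_add_sq_le_three _ _ _
  -- sum over the coarse bonds, reindexed through `bondShift`
  have hsum := Finset.sum_le_sum fun c (_ : c ∈ (Finset.univ : Finset (PBond (F.P n) 0))) => hpt c
  rw [← Finset.mul_sum, Finset.sum_add_distrib, Finset.sum_add_distrib] at hsum
  have hre1 : ∑ c : PBond (F.P n) 0, ‖((((F.P K).L : ℕ) : ℂ) ^ (K - n)) • bondAvgIter (K - n) X (bondShift (sites_eq F n K hnK.le) c)‖ ^ 2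
      = ∑ c : PBond (F.P K) (K - n), ‖((((F.P K).L : ℕ) : ℂ) ^ (K - n)) • bondAvgIter (K - n) X c‖ ^ 2 :=
    (bondShift (sites_eq F n K hnK.le)).sum_comp (fun c => ‖((((F.P K).L : ℕ) : ℂ) ^ (K - n)) • bondAvgIter (K - n) X c‖ ^ 2)
  have hre2 : ∑ c : PBond (F.P n) 0, ‖Λ (K - n) X (bondShift (sites_eq F n K hnK.le) c).tgt - Λ (K - n) X (bondShift (sites_eq F n K hnK.le) c).src‖ ^ 2
      = ∑ c : PBond (F.P K) (K - n), ‖Λ (K - n) X c.tgt - Λ (K - n) X c.src‖ ^ 2 :=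
    (bondShift (sites_eq F n K hnK.le)).sum_comp (fun c => ‖Λ (K - n) X c.tgt - Λ (K - n) X c.src‖ ^ 2)
  rw [hre1, hre2] at hsum
  -- bookkeeping
  set T := ∑ c : PBond (F.P K) (K - n), ‖((((F.P K).L : ℕ) : ℂ) ^ (K - n)) • bondAvgIter (K - n) X c‖ ^ 2 with hTdef
  set SΛ := ∑ c : PBond (F.P K) (K - n), ‖Λ (K - n) X c.tgt - Λ (K - n) X c.src‖ ^ 2 with hSΛdef
  set SR := ∑ c : PBond (F.P n) 0, ‖(∑ j ∈ Finset.range (K - n), Fhat (F.P K).L (linQIter (F.P K).L (fun z κ => X ⟨transl (basePt F n K) z, κ⟩) j) ((((F.P K).L : ℤ) ^ (K - n - j)) • coordT3 F n K hnK.le c.src)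
            - ∑ j ∈ Finset.range (K - n), Fhat (F.P K).L (linQIter (F.P K).L (fun z κ => X ⟨transl (basePt F n K) z, κ⟩) j) ((((F.P K).L : ℤ) ^ (K - n - j)) • coordT3 F n K hnK.le c.tgt))‖ ^ 2
    with hSRdef
  set M := ∑ b : PBond (F.P K) 0, ‖X b‖ ^ 2 with hM
  set G := ∑ x : Site (F.P K) 0, ∑ κ : Fin 3, ∑ ν : Fin 3, ‖X ⟨x.shift ν, κ⟩ - X ⟨x, κ⟩‖ ^ 2 with hG
  have hG0 : 0 ≤ G := Finset.sum_nonneg fun _ _ => Finset.sum_nonneg fun _ _ => Finset.sum_nonneg fun _ _ => sq_nonneg _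
  have hT' : ℓ * T ≤ M := hT
  have hEG : ∑ μ : Fin (F.P K).d, ∑ ν : Fin (F.P K).d, ∑ x : Site (F.P K) 0, ‖X ⟨x.shift ν, μ⟩ - X ⟨x, μ⟩‖ ^ 2 = G := by
    rw [hG]
    calc ∑ μ : Fin (F.P K).d, ∑ ν : Fin (F.P K).d, ∑ x : Site (F.P K) 0, ‖X ⟨x.shift ν, μ⟩ - X ⟨x, μ⟩‖ ^ 2
        = ∑ μ : Fin (F.P K).d, ∑ x : Site (F.P K) 0, ∑ ν : Fin (F.P K).d, ‖X ⟨x.shift ν, μ⟩ - X ⟨x, μ⟩‖ ^ 2 :=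
          Finset.sum_congr rfl fun μ _ => Finset.sum_comm
      _ = ∑ x : Site (F.P K) 0, ∑ μ : Fin (F.P K).d, ∑ ν : Fin (F.P K).d, ‖X ⟨x.shift ν, μ⟩ - X ⟨x, μ⟩‖ ^ 2 := Finset.sum_comm
  have hS' : SΛ ≤ CΛ * ℓ * G := by rw [← hEG]; exact hSX
  have hR' : SR ≤ Cr * ℓ * G := hRX
  have h1 : ℓ * ∑ c : PBond (F.P n) 0, ‖QTw F n K hnK.le 1 X c‖ ^ 2 ≤ ℓ * (3 * (T + SΛ + SR)) := mul_le_mul_of_nonneg_left hsum hℓ0.le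
  have h2 : ℓ * SΛ ≤ CΛ * ℓ ^ 2 * G := by nlinarith [hS', hℓ0.le]
  have h3 : ℓ * SR ≤ Cr * ℓ ^ 2 * G := by nlinarith [hR', hℓ0.le]
  calc ℓ * ∑ c : PBond (F.P n) 0, ‖QTw F n K hnK.le 1 X c‖ ^ 2 ≤ ℓ * (3 * (T + SΛ + SR)) := h1
    _ = 3 * (ℓ * T) + 3 * (ℓ * SΛ) + 3 * (ℓ * SR) := by ring
    _ ≤ 3 * M + 3 * (CΛ * ℓ ^ 2 * G) + 3 * (Cr * ℓ ^ 2 * G) := by linarith [hT', h2, h3]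
    _ = 3 * M + 3 * (CΛ + Cr) * ℓ ^ 2 * G := by ring

end Summit.QuantumFields.YangMills.Theorems.Prop7QTwOneH1Row

end
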